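import Literature.Computability.Cryptography.StatisticalDistanceMixtures
import Literature.Computability.Cryptography.LWE
import HarnessLib

/-!
# Statistical distance of iid products: the hybrid bound `Δ(p^{⊗N}, q^{⊗N}) ≤ N · Δ(p, q)`

Topic `Computability/Cryptography`; theorems-only companion of `StatisticalDistance.lean`
(`PMF.tvDist`), `StatisticalDistanceMixtures.lean` (events and mixtures) and of the iid product
`LWE.iidPMF p N : PMF (Fin N → α)` of `LWE.lean`. It proves the textbook hybrid argument for
independent samples (Goldreich 2001, §3.2.3, proof of Thm 3.2.6 "statistical/computational
indistinguishability is preserved under multiple samples": the `i`-th hybrid replaces the first `i`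
samples; each adjacent pair differs in one independent coordinate), in the exact `PMF` form:

* `PMF.tsum_toReal_mul_sub_le_tvDist`, `PMF.abs_tsum_toReal_mul_sub_le_tvDist` — **expectations of
  a `[0,1]`-valued function move by at most `Δ`**: `|E_p[h] − E_q[h]| ≤ Δ(p, q)` (the event form
  `|p S − q S| ≤ Δ` is the case of indicators, `abs_toReal_toOuterMeasure_sub_le_tvDist`);
* `LWE.abs_toReal_toOuterMeasure_iidPMF_sub_le` — **the hybrid bound on events**:
  `|p^{⊗N}(E) − q^{⊗N}(E)| ≤ N · Δ(p, q)` for every event `E ⊆ αᴺ`;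
* `LWE.tvDist_iidPMF_le` — hence `Δ(p^{⊗N}, q^{⊗N}) ≤ N · Δ(p, q)`.

Consumer: the analysis of Regev 2009, Lemma 3.17 (`GIVP ≤ DGS`), where the `n²` samples returned by
a `DGS` sampler whose output law is within `ν` of `D_{L,r}` are compared with `n²` exact samples
(cost `n² ν`, negligible).

## References

* O. Goldreich, *Foundations of Cryptography I*, CUP 2001, §3.2.3 (hybrid arguments; Thm 3.2.6 and
  its proof), §3.8.4 Exercise 5 [Goldreich2001].
-/

noncomputable section

open scoped ENNReal

namespace PMF

variable {α : Type*}

/-- Pointwise step of the expectation bound: `(p x − q x) h x ≤ 𝟙_{q < p}(x) (p x − q x)` for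
`0 ≤ h ≤ 1`. [folklore] -/
theorem sub_mul_le_indicator (p q : PMF α) {h : α → ℝ} (h0 : ∀ x, 0 ≤ h x) (h1 : ∀ x, h x ≤ 1)
    (x : α) :
    ((p x).toReal - (q x).toReal) * h x ≤
      {x | (q x).toReal < (p x).toReal}.indicator (fun x => (p x).toReal - (q x).toReal) x := by
  by_cases hx : (q x).toReal < (p x).toReal
  · rw [Set.indicator_of_mem (show x ∈ {x | (q x).toReal < (p x).toReal} from hx)]
    have : 0 ≤ (p x).toReal - (q x).toReal := by linarith
    nlinarith [h0 x, h1 x]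
  · rw [Set.indicator_of_notMem (show x ∉ {x | (q x).toReal < (p x).toReal} from hx)]
    have : (p x).toReal - (q x).toReal ≤ 0 := by linarith [not_lt.1 hx]
    nlinarith [h0 x, h1 x]

/-- **Expectations of `[0,1]`-valued functions move by at most the statistical distance** (signed
form): `E_p[h] − E_q[h] ≤ Δ(p, q)` for `0 ≤ h ≤ 1`. Proof: `∑ (p − q) h ≤ ∑_{q < p} (p − q) =
p S − q S ≤ Δ` for `S = {q < p}`. [cite: Goldreich2001, §3.8.4 Exercise 5] -/
theorem tsum_toReal_mul_sub_le_tvDist (p q : PMF α) {h : α → ℝ} (h0 : ∀ x, 0 ≤ h x)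
    (h1 : ∀ x, h x ≤ 1) :
    ∑' x, (p x).toReal * h x - ∑' x, (q x).toReal * h x ≤ p.tvDist q := by
  have habs : ∀ x, |h x| ≤ 1 := fun x => abs_le.2 ⟨by linarith [h0 x], h1 x⟩
  have hsp := summable_toReal_mul_of_abs_le_one p habs
  have hsq := summable_toReal_mul_of_abs_le_one q habs
  set S : Set α := {x | (q x).toReal < (p x).toReal} with hS
  have hindp : Summable fun x => S.indicator (fun x => (p x).toReal) x :=
    (summable_coe_toReal p).indicator S
  have hindq : Summable fun x => S.indicator (fun x => (q x).toReal) x :=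
    (summable_coe_toReal q).indicator S
  have hind : (fun x => S.indicator (fun x => (p x).toReal - (q x).toReal) x) =
      fun x => S.indicator (fun x => (p x).toReal) x - S.indicator (fun x => (q x).toReal) x := by
    funext x
    by_cases hx : x ∈ S
    · simp only [Set.indicator_of_mem hx]
    · simp only [Set.indicator_of_notMem hx, sub_zero]
  have hindS : Summable fun x => S.indicator (fun x => (p x).toReal - (q x).toReal) x := by
    rw [hind]; exact hindp.sub hindq
  rw [← hsp.tsum_sub hsq]
  calc ∑' x, ((p x).toReal * h x - (q x).toReal * h x)
      ≤ ∑' x, S.indicator (fun x => (p x).toReal - (q x).toReal) x := by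
        refine (hsp.sub hsq).tsum_le_tsum (fun x => ?_) hindS
        rw [← sub_mul]; exact sub_mul_le_indicator p q h0 h1 x
    _ = (p.toOuterMeasure S).toReal - (q.toOuterMeasure S).toReal := by
        rw [hind, hindp.tsum_sub hindq, toReal_toOuterMeasure_apply, toReal_toOuterMeasure_apply]
    _ ≤ p.tvDist q := toReal_toOuterMeasure_sub_le_tvDist p q S

/-- **`|E_p[h] − E_q[h]| ≤ Δ(p, q)` for `0 ≤ h ≤ 1`.** [cite: Goldreich2001, §3.8.4 Exercise 5] -/
theorem abs_tsum_toReal_mul_sub_le_tvDist (p q : PMF α) {h : α → ℝ} (h0 : ∀ x, 0 ≤ h x)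
    (h1 : ∀ x, h x ≤ 1) :
    |∑' x, (p x).toReal * h x - ∑' x, (q x).toReal * h x| ≤ p.tvDist q := by
  rw [abs_le]
  refine ⟨?_, tsum_toReal_mul_sub_le_tvDist p q h0 h1⟩
  have h := tsum_toReal_mul_sub_le_tvDist q p h0 h1
  rw [tvDist_comm] at h
  linarith

end PMF

namespace Literature.Computability.Cryptography

namespace LWE

variable {α : Type}

/-- **The hybrid bound for iid products, event form** (Goldreich 2001, §3.2.3, proof of Thm 3.2.6):
for every `N` and every event `E ⊆ αᴺ`, `|p^{⊗N}(E) − q^{⊗N}(E)| ≤ N · Δ(p, q)`. Induction on `N`: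
`p^{⊗(N+1)}(E) = ∑_x p(x) · p^{⊗N}(E_x)` with the section `E_x = {v | (x, v) ∈ E}`, and
`∑_x p(x) p^{⊗N}(E_x) − ∑_x q(x) q^{⊗N}(E_x) = ∑_x p(x) (p^{⊗N}(E_x) − q^{⊗N}(E_x)) +
(E_p − E_q)[x ↦ q^{⊗N}(E_x)]`, the first term `≤ N Δ` by induction, the second `≤ Δ` by
`abs_tsum_toReal_mul_sub_le_tvDist`. [cite: Goldreich2001, §3.2.3 (Thm 3.2.6, proof)] -/
theorem abs_toReal_toOuterMeasure_iidPMF_sub_le (p q : PMF α) :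
    ∀ (N : ℕ) (E : Set (Fin N → α)),
      |((iidPMF p N).toOuterMeasure E).toReal - ((iidPMF q N).toOuterMeasure E).toReal| ≤
        N * p.tvDist q
  | 0, E => by simp
  | N + 1, E => by
    -- sections
    set a : α → ℝ := fun x =>
      ((iidPMF p N).toOuterMeasure ((fun v : Fin N → α => (Fin.cons x v : Fin (N + 1) → α)) ⁻¹' E)).toReal
      with ha
    set b : α → ℝ := fun x =>
      ((iidPMF q N).toOuterMeasure ((fun v : Fin N → α => (Fin.cons x v : Fin (N + 1) → α)) ⁻¹' E)).toReal
      with hb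
    have hpE : ((iidPMF p (N + 1)).toOuterMeasure E).toReal = ∑' x, (p x).toReal * a x := by
      rw [iidPMF_succ, PMF.toReal_toOuterMeasure_bind_apply]
      refine tsum_congr fun x => ?_
      rw [PMF.toOuterMeasure_map_apply]
    have hqE : ((iidPMF q (N + 1)).toOuterMeasure E).toReal = ∑' x, (q x).toReal * b x := by
      rw [iidPMF_succ, PMF.toReal_toOuterMeasure_bind_apply]
      refine tsum_congr fun x => ?_
      rw [PMF.toOuterMeasure_map_apply]
    have hb0 : ∀ x, 0 ≤ b x := fun x => ENNReal.toReal_nonneg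
    have hb1 : ∀ x, b x ≤ 1 := fun x => PMF.toReal_toOuterMeasure_le_one _ _
    have ha1 : ∀ x, |a x| ≤ 1 := fun x => by
      rw [ha, abs_of_nonneg ENNReal.toReal_nonneg]; exact PMF.toReal_toOuterMeasure_le_one _ _
    have hb1' : ∀ x, |b x| ≤ 1 := fun x => abs_le.2 ⟨by linarith [hb0 x], hb1 x⟩
    have hih : ∀ x, |a x - b x| ≤ N * p.tvDist q := fun x =>
      abs_toReal_toOuterMeasure_iidPMF_sub_le p q N _
    have hspa := PMF.summable_toReal_mul_of_abs_le_one p ha1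
    have hspb := PMF.summable_toReal_mul_of_abs_le_one p hb1'
    rw [hpE, hqE]
    -- split
    have hsplit : ∑' x, (p x).toReal * a x - ∑' x, (q x).toReal * b x =
        ∑' x, (p x).toReal * (a x - b x) + (∑' x, (p x).toReal * b x - ∑' x, (q x).toReal * b x) := by
      have hsub : ∑' x, (p x).toReal * (a x - b x) =
          ∑' x, (p x).toReal * a x - ∑' x, (p x).toReal * b x := by
        rw [← hspa.tsum_sub hspb]
        exact tsum_congr fun x => by ring
      rw [hsub]
      ring
    rw [hsplit]
    refine (abs_add_le _ _).trans ?_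
    have h1 : |∑' x, (p x).toReal * (a x - b x)| ≤ N * p.tvDist q := by
      have hsum : Summable fun x => (p x).toReal * (a x - b x) := by
        simp_rw [mul_sub]; exact hspa.sub hspb
      refine (norm_tsum_le_tsum_norm hsum.norm).trans ?_
      simp only [Real.norm_eq_abs]
      have hbd : Summable fun x => (p x).toReal * (N * p.tvDist q) := (PMF.summable_coe_toReal p).mul_right _
      calc ∑' x, |(p x).toReal * (a x - b x)| ≤ ∑' x, (p x).toReal * (N * p.tvDist q) := by
            refine hsum.norm.tsum_le_tsum (fun x => ?_) hbd
            change |(p x).toReal * (a x - b x)| ≤ _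
            rw [abs_mul, abs_of_nonneg ENNReal.toReal_nonneg]
            exact mul_le_mul_of_nonneg_left (hih x) ENNReal.toReal_nonneg
        _ = N * p.tvDist q := by rw [tsum_mul_right, PMF.tsum_coe_toReal, one_mul]
    have h2 := PMF.abs_tsum_toReal_mul_sub_le_tvDist p q hb0 hb1
    push_cast
    linarith

/-- **`Δ(p^{⊗N}, q^{⊗N}) ≤ N · Δ(p, q)`** (Goldreich 2001, §3.2.3: statistical closeness is
preserved under `N` independent samples, with loss factor `N`). [cite: Goldreich2001, §3.2.3 (Thm 3.2.6, proof)] -/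
theorem tvDist_iidPMF_le (p q : PMF α) (N : ℕ) :
    (iidPMF p N).tvDist (iidPMF q N) ≤ N * p.tvDist q := by
  rw [PMF.tvDist_eq_iSup_measure_holds]
  refine ciSup_le fun E => ?_
  exact (le_abs_self _).trans (abs_toReal_toOuterMeasure_iidPMF_sub_le p q N E)

end LWE

end Literature.Computability.Cryptography

end
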